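import Summits.QuantumFields.YangMills.Theorems.UnitScaleTiltProp8FlatProp4Dressing
import HarnessLib

/-!
# Route `UnitScaleTilt`, crux K1 child «MinimiserStabilityRegPr» (stmt-QuantumFields-19200), registered stub V2′ `stub_halvingStep`
# (skeletons v8 5b4e846794b80374 ∕ v10 `BirthV10`) — **THE DRESSING LETTER `C_E` OF PROPOSITION 4's (98) FOR THE DRESSED GRADIENT
# `W = W₀∘(1 − H∘D) + E`, KNIT FROM THE DISPLAYED SUPPLIER LETTERS (X1) ∕ (X2a) ∕ (X2-T)** (★★OWNER g25 W-SEAT MAP #3 row M2 (H-CE), the knit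
# half; OWNER g26 ASSIGNMENTS 8 (b): «the M2 KNIT … p598408 `hWq_of_dressing`'s `hE` for w5 g3's explicit E = E₁+E₂+E₃ ⇐ (X1) + (X2) letters + (46) + (55),
# every not-yet-landed supplier DISPLAYED in its announced shape»)

Cell `ym3-torus` (HUMAN RULING D-0037, YM ladder rung R3 — continuum SU(2) YM₃ on the torus is a RUNG, not the Clay problem), width seat
`ym-ust-19200-w6` gen 0 (D-0154 (3c)).  `--supports stmt-QuantumFields-19200 --as helper`; def-free, 0 sorry, standard axioms.

WHY.  ✓ p598408 `FlatProp4Dressing.hWq_of_dressing` composes Proposition 4's (98) for the dressed gradient `W Y = W₀(Y − H(D Y)) + E Y` from (98) for the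
pure-action gradient `W₀` (P3b ✓ p596336 ∕ p600749), (46) for `H`, (55) for `D`, and ONE abstract quadratic letter `hE : w₃‖E Y‖ ≤ C_E·r²`; ✓ p605698
`HalvingDressedCriticality.fderiv_dressed_eq_pairing` made `E` EXPLICIT (the Riesz field of the remainder functional
`ℓ_Y(ε) = −(η²/2)Σ_p tr(Φ_p(H(D Y))Φ_p(ε)) − (η²/2)Σ_p tr(Φ_p(ΨY)Φ_p(H(D′(Y)ε))) − η⁴Σ_b tr(W₀(ΨY)_b(H(D′(Y)ε))_b)`, `Ψ = 1 − H∘D`) and located that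
`C_E` for THIS `E` is not a one-letter affair (seat w5 g3 LOCATE 04:38Z: print's (85)–(89) use [5] (3.132) and (73)).  THIS FILE does the algebra and the
bookkeeping once and for all: it identifies `E` with the three (85)–(89)-type terms `E₁ = −½·CC(H(D Y))`, `E₂ = −½·T_Yᵀ[CC(ΨY)]`, `E₃ = −T_Yᵀ[W₀(ΨY)]`
(`CC` = the flat curl–curl `η⁻²Σ_p σ(p,b)Φ_p`, i.e. P2's `dcsE c ∘ dcE c`, `c = η⁻¹ = L^{K−n}`, read entrywise; `T_Y = H∘D′(Y)`, transpose for the pairing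
`η⁴Σ_b tr(X_bδ_b)`), and derives `hE` — hence (98) for `W` — from THREE DISPLAYED supplier letters: **(X1)** the curl–curl sup row of `H`
(★w3-19936 g4 ✓ p606150 `FlatHCurlCurlSupRow.curlCurlSupRow_of_kernelRows` for the flat `H`; matrix∕chart bridge displayed), **(X2a)** the composite transpose
letter `w₃‖T_Yᵀ[CC Z]‖ ≤ B₂·r·s` and **(X2-T)** `w₃‖T_Yᵀ J‖ ≤ B₃·r·t` (★w8-19936 g0 `DressingTransposeLetters.X2a_of_X2D_CCHt` ∕ `X2T_letter`, in their
`Matrix.of` shapes), next to (98)₀, (46), (55).  Print: *«Applying the inequalities (3.132) from [5], (55), (73) … we can estimate this functional derivative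
by O(1)ε₃²(Lʲη)⁻³ on Ωⱼ»* (p. 291, after (88)); *«(89) … can be estimated by O(1)ε₃³(Lʲη)⁻³»*.

WHAT THIS FILE PROVES (no definition, no sorry):
* §1 (generic finite-index currency of `hWq_of_dressing`: `src tgt : κ → ι`, weights `w₀ w₁ w₃`) **`hE_of_letters`** — for ANY `E` of the three-term form
  `E Y = −½·CC(H(D Y)) − ½·TT Y (CC(ΨY)) − TT Y (W₀(ΨY))` (abstract maps `CC`, `TT`): (98)₀ ∧ (46) ∧ (55) ∧ (X1) ∧ (X2a) ∧ (X2-T) ⟹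
  `w₃‖E Y‖ ≤ C_E·r²` below `a₃` (`a₃ ≤ R₀ < R`, `θa₃ ≤ a₀`), `C_E = 2B_ΔC₂ + ½B₂θ + B₃R₀C₀θ²`, `θ = 1 + 4B_HC₂R₀`
  (E₁ via (X1)∘(55); E₂ via (X2a) at `Z = ΨY`, `size(ΨY) ≤ θr` ✓ `FlatProp4Dressing.size_chartShift_le`; E₃ via (X2-T)∘(98)₀); **`hWq_of_letters`** —
  then `w₃‖W Y‖ ≤ (C₀θ² + C_E)·r²` (the `hWq` shape, `C_E` discharged modulo the three letters).
* §2 (level-0 bonds, `M₂(ℂ)`-valued fields; pure finite-dimensional algebra) `trace_mul_single_one`, `single_field_apply`, `sum_indicator_smul_apply`,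
  ★`sum_trace_plaq_mul` (summation by parts `Σ_p tr(Φ_p(A)Φ_p(V)) = Σ_{b′} tr((Σ_p σ(p,b′)•Φ_p(A))·V_{b′})`, `σ(p,b) = Φ_p(𝟙_b)`), and
  ★★**`dressing_eq_three_terms`** — the `E` of `fderiv_dressed_eq_pairing` (hypothesis `hE` VERBATIM) IS `−½·CC(H(D Y)) − ½·T_Yᵀ[CC(ΨY)] − T_Yᵀ[W₀(ΨY)]`
  with `CC Z b = η⁻²·Σ_p σ(p,b)•Φ_p(Z)` and `(T_Yᵀ J)(b) = (Σ_{b′} tr(J_{b′}·(H(D′(Y)e_{b,ji}))_{b′}))_{ij}`, `e_{b,ji} = Pi.single b (Matrix.single j i 1)`.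
* §3 ★★**`hWq_dressed_of_letters`** — at level-0 bonds of any `P`, level weights `w 1`, `w 2·c`, `w 3` (the cube-sequence socket's currency): (98) for
  `W = W₀∘Ψ + E`, `E` explicit, from the displayed letters in exactly the shapes the suppliers announced ((X1): `0 ≤ t → (∀ c, ‖X c‖ ≤ t) → ∀ b,
  w 3 b·‖CC(HX) b‖ ≤ B_Δ·t`; (X2a)∕(X2-T): the `Matrix.of` transposes).
* The d = 3 readings (cube sequence with P3b's `W₀` by name; the one-level `hE` binder of `exists_dressed_gradient_T3`) are the companion file
  `UnitScaleTiltProp8HalvingDressingLetterT3`.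
HONEST SCOPE.  (i) NO supplier letter is proved here: (X1) for the chart-`H` of record needs the matrix∕flat bridge (`ChartHInvBridge`, (X3′) tents); (X2a) and
(X2-T) are ★w8-19936 g0's theorems modulo the column letters (X2-H), (X2-C′), (X2-CH) (OWNER g26 ASSIGNMENTS 10 (b)); (46) at the two-letter level waits
on (X3′); (55) is P3a's `chart47W`.  (ii) The identification of the route's minimiser with a critical point of the dressed functional is ✓ p605698 §3, not this
file.  (iii) NOT a claim about the stub, the crux, the rung or the mass gap; no summit statement is proved by this seat.

References: T. Bałaban, CMP **102** (1985) 277–309 [Balaban1985Variational] (5) p.278, (27) p.282, (46)–(47) p.285, (55) p.286, (73) p.289,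
(80)–(89) pp.290–291, Prop. 4 (97)–(98) pp.292–293, (144) p.300, (152) p.301, (157)–(158) p.302; T. Bałaban, CMP **96** (1984) 223–250
[Balaban1984PropagatorsII] (2.19) p.226 (the flat `∂*∂`).
-/

set_option autoImplicit false

noncomputable section

open scoped BigOperators Matrix Matrix.Norms.L2Operator
open NormedSpace

namespace Summit.QuantumFields.YangMills.Theorems.HalvingDressingLetter

open Literature.MathematicalPhysics.QuantumFieldTheory.Balaban1983to89
open FlatProp4Dressing (size_chartShift_le)

/-! ## §1 The dressing letter from the three displayed supplier letters — generic weighted currency -/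

section Generic

variable {ι κ β' : Type*} {V : Type*} [NormedAddCommGroup V] [NormedSpace ℂ V]
variable (src tgt : κ → ι) (w₀ w₃ : ι → ℝ) (w₁ : κ → ℝ)

/-- **THE DRESSING LETTER `C_E` FROM THREE SUPPLIER LETTERS** (generic finite-index currency of `FlatProp4Dressing.hWq_of_dressing`:
«size of `Y` ≤ r» := `w₀ i‖Y i‖ ≤ r ∀ i ∧ w₁ p‖Y(tgt p) − Y(src p)‖ ≤ r ∀ p`, currents weighted by `w₃`).  If the dressing term has the
three-term form `E Y = −½·CC(H(D Y)) − ½·T_Yᵀ[CC(ΨY)] − T_Yᵀ[W₀(ΨY)]` (`Ψ = 1 − H∘D`; `CC` = the flat `∂*∂`, `T_Yᵀ` = the transpose of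
`H∘D′(Y)` — abstract maps here), then (98) for `W₀` (`C₀` below `a₀`), (46) for `H` (`B_H`), (55) for `D` (`4C₂r²` below `R`), the curl–curl sup
row (X1) `w₃‖CC(HX)‖ ≤ B_Δ·sup‖X‖`, the composite transpose letter (X2a) `w₃‖T_Yᵀ[CC Z]‖ ≤ B₂·r·s` (`size(Y) ≤ r < R`, `size(Z) ≤ s`) and the
transpose letter (X2-T) `w₃‖T_Yᵀ J‖ ≤ B₃·r·sup w₃‖J‖` give `w₃(i)‖E(Y)(i)‖ ≤ C_E·r²` for every `Y` of size `≤ r < a₃`, `a₃ ≤ R₀ < R`,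
`(1 + 4B_HC₂R₀)a₃ ≤ a₀`, with `C_E = 2B_ΔC₂ + ½B₂θ + B₃R₀C₀θ²`, `θ = 1 + 4B_HC₂R₀` (print: the (85)–(89) terms are `O(1)ε₃²(Lʲη)⁻³`).
[cite: Balaban1985Variational, (84)-(89) pp.290-291, Prop. 4 (97)-(98) pp.292-293, (157) p.302] -/
theorem hE_of_letters (E W₀ CC : (ι → V) → (ι → V)) (TT : (ι → V) → (ι → V) → (ι → V))
    (H : (β' → V) →ₗ[ℂ] (ι → V)) (D : (ι → V) → (β' → V)) {C₀ a₀ B_H C₂ R R₀ a₃ B_Δ B₂ B₃ : ℝ}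
    (hErepr : ∀ Y i, E Y i = -((2 : ℂ)⁻¹ • CC (H (D Y)) i) - (2 : ℂ)⁻¹ • TT Y (CC (Y - H (D Y))) i - TT Y (W₀ (Y - H (D Y))) i)
    (hW₀ : ∀ (Z : ι → V) (s : ℝ), s < a₀ → (∀ i, w₀ i * ‖Z i‖ ≤ s) → (∀ p, w₁ p * ‖Z (tgt p) - Z (src p)‖ ≤ s) →
      ∀ i, w₃ i * ‖W₀ Z i‖ ≤ C₀ * s ^ 2)
    (hH : ∀ (X : β' → V) (t : ℝ), (∀ c, ‖X c‖ ≤ t) →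
      (∀ i, w₀ i * ‖H X i‖ ≤ B_H * t) ∧ ∀ p, w₁ p * ‖H X (tgt p) - H X (src p)‖ ≤ B_H * t)
    (hD : ∀ (Y : ι → V) (r' : ℝ), r' < R → (∀ i, w₀ i * ‖Y i‖ ≤ r') → (∀ p, w₁ p * ‖Y (tgt p) - Y (src p)‖ ≤ r') →
      ∀ c, ‖D Y c‖ ≤ 4 * C₂ * r' ^ 2)
    (hX1 : ∀ (X : β' → V) (t : ℝ), 0 ≤ t → (∀ c, ‖X c‖ ≤ t) → ∀ i, w₃ i * ‖CC (H X) i‖ ≤ B_Δ * t)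
    (hX2a : ∀ (Y : ι → V) (r : ℝ), r < R → (∀ i, w₀ i * ‖Y i‖ ≤ r) → (∀ p, w₁ p * ‖Y (tgt p) - Y (src p)‖ ≤ r) →
      ∀ (Z : ι → V) (s : ℝ), 0 ≤ s → (∀ i, w₀ i * ‖Z i‖ ≤ s) → (∀ p, w₁ p * ‖Z (tgt p) - Z (src p)‖ ≤ s) →
      ∀ i, w₃ i * ‖TT Y (CC Z) i‖ ≤ B₂ * r * s)
    (hX2T : ∀ (Y : ι → V) (r : ℝ), r < R → (∀ i, w₀ i * ‖Y i‖ ≤ r) → (∀ p, w₁ p * ‖Y (tgt p) - Y (src p)‖ ≤ r) →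
      ∀ (J : ι → V) (t : ℝ), 0 ≤ t → (∀ i, w₃ i * ‖J i‖ ≤ t) → ∀ i, w₃ i * ‖TT Y J i‖ ≤ B₃ * r * t)
    (hC₂ : 0 ≤ C₂) (hB_H : 0 ≤ B_H) (hB₃ : 0 ≤ B₃) (hR₀0 : 0 ≤ R₀) (hR₀ : R₀ < R) (ha₃ : a₃ ≤ R₀) (hθ : (1 + 4 * B_H * C₂ * R₀) * a₃ ≤ a₀)
    (hw₀ : ∀ i, 0 ≤ w₀ i) (hw₁ : ∀ p, 0 ≤ w₁ p) (hw₃ : ∀ i, 0 ≤ w₃ i) :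
    ∀ (Y : ι → V) (r : ℝ), r < a₃ → (∀ i, w₀ i * ‖Y i‖ ≤ r) → (∀ p, w₁ p * ‖Y (tgt p) - Y (src p)‖ ≤ r) →
      ∀ i, w₃ i * ‖E Y i‖ ≤
        (2 * B_Δ * C₂ + 2⁻¹ * B₂ * (1 + 4 * B_H * C₂ * R₀) + B₃ * R₀ * C₀ * (1 + 4 * B_H * C₂ * R₀) ^ 2) * r ^ 2 := by
  intro Y r hr h1 h2 i
  have hr0 : 0 ≤ r := (mul_nonneg (hw₀ i) (norm_nonneg _)).trans (h1 i)
  have hθ1 : (0 : ℝ) < 1 + 4 * B_H * C₂ * R₀ := by positivity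
  have hrR : r < R := lt_of_lt_of_le hr (ha₃.trans hR₀.le)
  have hshift := size_chartShift_le src tgt w₀ w₁ H D hC₂ hR₀ hH hD Y hr0 (hr.le.trans ha₃) h1 h2 hw₀ hw₁
  have hθr : (1 + 4 * B_H * C₂ * R₀) * r < a₀ := lt_of_lt_of_le (mul_lt_mul_of_pos_left hr hθ1) hθ
  -- the three terms
  have hE1 : w₃ i * ‖CC (H (D Y)) i‖ ≤ B_Δ * (4 * C₂ * r ^ 2) := hX1 (D Y) _ (by positivity) (hD Y r hrR h1 h2) i
  have hE2 : w₃ i * ‖TT Y (CC (Y - H (D Y))) i‖ ≤ B₂ * r * ((1 + 4 * B_H * C₂ * R₀) * r) :=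
    hX2a Y r hrR h1 h2 (Y - H (D Y)) _ (mul_nonneg hθ1.le hr0) hshift.1 hshift.2 i
  have hW₀b := hW₀ (Y - H (D Y)) _ hθr hshift.1 hshift.2
  have ht3 : 0 ≤ C₀ * ((1 + 4 * B_H * C₂ * R₀) * r) ^ 2 := (mul_nonneg (hw₃ i) (norm_nonneg _)).trans (hW₀b i)
  have hE3' : w₃ i * ‖TT Y (W₀ (Y - H (D Y))) i‖ ≤ B₃ * r * (C₀ * ((1 + 4 * B_H * C₂ * R₀) * r) ^ 2) :=
    hX2T Y r hrR h1 h2 _ _ ht3 hW₀b i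
  have hE3 : w₃ i * ‖TT Y (W₀ (Y - H (D Y))) i‖ ≤ B₃ * R₀ * (C₀ * ((1 + 4 * B_H * C₂ * R₀) * r) ^ 2) :=
    hE3'.trans (mul_le_mul_of_nonneg_right (mul_le_mul_of_nonneg_left (hr.le.trans ha₃) hB₃) ht3)
  -- combine
  rw [hErepr Y i]
  have hn2 : ‖(2 : ℂ)⁻¹‖ = 2⁻¹ := by simp
  have htri : ‖-((2 : ℂ)⁻¹ • CC (H (D Y)) i) - (2 : ℂ)⁻¹ • TT Y (CC (Y - H (D Y))) i - TT Y (W₀ (Y - H (D Y))) i‖ ≤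
      2⁻¹ * ‖CC (H (D Y)) i‖ + 2⁻¹ * ‖TT Y (CC (Y - H (D Y))) i‖ + ‖TT Y (W₀ (Y - H (D Y))) i‖ := by
    calc ‖-((2 : ℂ)⁻¹ • CC (H (D Y)) i) - (2 : ℂ)⁻¹ • TT Y (CC (Y - H (D Y))) i - TT Y (W₀ (Y - H (D Y))) i‖
        ≤ ‖-((2 : ℂ)⁻¹ • CC (H (D Y)) i) - (2 : ℂ)⁻¹ • TT Y (CC (Y - H (D Y))) i‖ + ‖TT Y (W₀ (Y - H (D Y))) i‖ := norm_sub_le _ _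
      _ ≤ (‖-((2 : ℂ)⁻¹ • CC (H (D Y)) i)‖ + ‖(2 : ℂ)⁻¹ • TT Y (CC (Y - H (D Y))) i‖) + ‖TT Y (W₀ (Y - H (D Y))) i‖ := by
          gcongr; exact norm_sub_le _ _
      _ = 2⁻¹ * ‖CC (H (D Y)) i‖ + 2⁻¹ * ‖TT Y (CC (Y - H (D Y))) i‖ + ‖TT Y (W₀ (Y - H (D Y))) i‖ := by
          rw [norm_neg, norm_smul, norm_smul, hn2]
  have hmul := mul_le_mul_of_nonneg_left htri (hw₃ i)
  have hexp : w₃ i * (2⁻¹ * ‖CC (H (D Y)) i‖ + 2⁻¹ * ‖TT Y (CC (Y - H (D Y))) i‖ + ‖TT Y (W₀ (Y - H (D Y))) i‖) =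
      2⁻¹ * (w₃ i * ‖CC (H (D Y)) i‖) + 2⁻¹ * (w₃ i * ‖TT Y (CC (Y - H (D Y))) i‖) + w₃ i * ‖TT Y (W₀ (Y - H (D Y))) i‖ := by ring
  rw [hexp] at hmul
  have hfin : 2⁻¹ * (w₃ i * ‖CC (H (D Y)) i‖) + 2⁻¹ * (w₃ i * ‖TT Y (CC (Y - H (D Y))) i‖) + w₃ i * ‖TT Y (W₀ (Y - H (D Y))) i‖ ≤
      (2 * B_Δ * C₂ + 2⁻¹ * B₂ * (1 + 4 * B_H * C₂ * R₀) + B₃ * R₀ * C₀ * (1 + 4 * B_H * C₂ * R₀) ^ 2) * r ^ 2 := by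
    have e : (2 * B_Δ * C₂ + 2⁻¹ * B₂ * (1 + 4 * B_H * C₂ * R₀) + B₃ * R₀ * C₀ * (1 + 4 * B_H * C₂ * R₀) ^ 2) * r ^ 2 =
        2⁻¹ * (B_Δ * (4 * C₂ * r ^ 2)) + 2⁻¹ * (B₂ * r * ((1 + 4 * B_H * C₂ * R₀) * r)) +
          B₃ * R₀ * (C₀ * ((1 + 4 * B_H * C₂ * R₀) * r) ^ 2) := by ring
    rw [e]
    exact add_le_add (add_le_add (mul_le_mul_of_nonneg_left hE1 (by norm_num)) (mul_le_mul_of_nonneg_left hE2 (by norm_num))) hE3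
  exact hmul.trans hfin

/-- **PROPOSITION 4's (98) FOR THE DRESSED GRADIENT `W = W₀∘(1 − H∘D) + E`, ALL THREE DRESSING TERMS INCLUDED**: under the hypotheses of
`hE_of_letters`, `w₃(i)‖W(Y)(i)‖ ≤ (C₀θ² + C_E)·r²` for every `Y` of size `≤ r < a₃` — the `hWq` shape of
`FlatSmallSolution158Levels.existsUnique_smallSolution158W` ∕ `FlatProp4Dressing.hWq_of_dressing` with `C_E` DISCHARGED modulo (X1), (X2a), (X2-T).
[cite: Balaban1985Variational, Prop. 4 (97)-(98) pp.292-293, (80)-(89) pp.290-291, (157)-(158) p.302] -/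
theorem hWq_of_letters (W E W₀ CC : (ι → V) → (ι → V)) (TT : (ι → V) → (ι → V) → (ι → V))
    (H : (β' → V) →ₗ[ℂ] (ι → V)) (D : (ι → V) → (β' → V)) {C₀ a₀ B_H C₂ R R₀ a₃ B_Δ B₂ B₃ : ℝ}
    (hW : ∀ Y, W Y = W₀ (Y - H (D Y)) + E Y)
    (hErepr : ∀ Y i, E Y i = -((2 : ℂ)⁻¹ • CC (H (D Y)) i) - (2 : ℂ)⁻¹ • TT Y (CC (Y - H (D Y))) i - TT Y (W₀ (Y - H (D Y))) i)
    (hW₀ : ∀ (Z : ι → V) (s : ℝ), s < a₀ → (∀ i, w₀ i * ‖Z i‖ ≤ s) → (∀ p, w₁ p * ‖Z (tgt p) - Z (src p)‖ ≤ s) →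
      ∀ i, w₃ i * ‖W₀ Z i‖ ≤ C₀ * s ^ 2)
    (hH : ∀ (X : β' → V) (t : ℝ), (∀ c, ‖X c‖ ≤ t) →
      (∀ i, w₀ i * ‖H X i‖ ≤ B_H * t) ∧ ∀ p, w₁ p * ‖H X (tgt p) - H X (src p)‖ ≤ B_H * t)
    (hD : ∀ (Y : ι → V) (r' : ℝ), r' < R → (∀ i, w₀ i * ‖Y i‖ ≤ r') → (∀ p, w₁ p * ‖Y (tgt p) - Y (src p)‖ ≤ r') →
      ∀ c, ‖D Y c‖ ≤ 4 * C₂ * r' ^ 2)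
    (hX1 : ∀ (X : β' → V) (t : ℝ), 0 ≤ t → (∀ c, ‖X c‖ ≤ t) → ∀ i, w₃ i * ‖CC (H X) i‖ ≤ B_Δ * t)
    (hX2a : ∀ (Y : ι → V) (r : ℝ), r < R → (∀ i, w₀ i * ‖Y i‖ ≤ r) → (∀ p, w₁ p * ‖Y (tgt p) - Y (src p)‖ ≤ r) →
      ∀ (Z : ι → V) (s : ℝ), 0 ≤ s → (∀ i, w₀ i * ‖Z i‖ ≤ s) → (∀ p, w₁ p * ‖Z (tgt p) - Z (src p)‖ ≤ s) →
      ∀ i, w₃ i * ‖TT Y (CC Z) i‖ ≤ B₂ * r * s)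
    (hX2T : ∀ (Y : ι → V) (r : ℝ), r < R → (∀ i, w₀ i * ‖Y i‖ ≤ r) → (∀ p, w₁ p * ‖Y (tgt p) - Y (src p)‖ ≤ r) →
      ∀ (J : ι → V) (t : ℝ), 0 ≤ t → (∀ i, w₃ i * ‖J i‖ ≤ t) → ∀ i, w₃ i * ‖TT Y J i‖ ≤ B₃ * r * t)
    (hC₂ : 0 ≤ C₂) (hB_H : 0 ≤ B_H) (hB₃ : 0 ≤ B₃) (hR₀0 : 0 ≤ R₀) (hR₀ : R₀ < R) (ha₃ : a₃ ≤ R₀) (hθ : (1 + 4 * B_H * C₂ * R₀) * a₃ ≤ a₀)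
    (hw₀ : ∀ i, 0 ≤ w₀ i) (hw₁ : ∀ p, 0 ≤ w₁ p) (hw₃ : ∀ i, 0 ≤ w₃ i) :
    ∀ (Y : ι → V) (r : ℝ), r < a₃ → (∀ i, w₀ i * ‖Y i‖ ≤ r) → (∀ p, w₁ p * ‖Y (tgt p) - Y (src p)‖ ≤ r) →
      ∀ i, w₃ i * ‖W Y i‖ ≤
        (C₀ * (1 + 4 * B_H * C₂ * R₀) ^ 2 +
          (2 * B_Δ * C₂ + 2⁻¹ * B₂ * (1 + 4 * B_H * C₂ * R₀) + B₃ * R₀ * C₀ * (1 + 4 * B_H * C₂ * R₀) ^ 2)) * r ^ 2 := by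
  intro Y r hr h1 h2 i
  have hr0 : 0 ≤ r := (mul_nonneg (hw₀ i) (norm_nonneg _)).trans (h1 i)
  have hθ1 : (0 : ℝ) < 1 + 4 * B_H * C₂ * R₀ := by positivity
  have hshift := size_chartShift_le src tgt w₀ w₁ H D hC₂ hR₀ hH hD Y hr0 (hr.le.trans ha₃) h1 h2 hw₀ hw₁
  have hθr : (1 + 4 * B_H * C₂ * R₀) * r < a₀ := lt_of_lt_of_le (mul_lt_mul_of_pos_left hr hθ1) hθ
  have hW₀b := hW₀ (Y - H (D Y)) _ hθr hshift.1 hshift.2 i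
  have hEb := hE_of_letters src tgt w₀ w₃ w₁ E W₀ CC TT H D hErepr hW₀ hH hD hX1 hX2a hX2T hC₂ hB_H hB₃ hR₀0 hR₀ ha₃ hθ hw₀ hw₁ hw₃
    Y r hr h1 h2 i
  rw [hW Y, Pi.add_apply]
  calc w₃ i * ‖W₀ (Y - H (D Y)) i + E Y i‖ ≤ w₃ i * (‖W₀ (Y - H (D Y)) i‖ + ‖E Y i‖) :=
        mul_le_mul_of_nonneg_left (norm_add_le _ _) (hw₃ i)
    _ = w₃ i * ‖W₀ (Y - H (D Y)) i‖ + w₃ i * ‖E Y i‖ := mul_add _ _ _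
    _ ≤ C₀ * ((1 + 4 * B_H * C₂ * R₀) * r) ^ 2 +
          (2 * B_Δ * C₂ + 2⁻¹ * B₂ * (1 + 4 * B_H * C₂ * R₀) + B₃ * R₀ * C₀ * (1 + 4 * B_H * C₂ * R₀) ^ 2) * r ^ 2 :=
        add_le_add hW₀b hEb
    _ = _ := by ring

end Generic

/-! ## §2 At level-0 bonds: the explicit dressing term of `HalvingDressedCriticality.fderiv_dressed_eq_pairing` IS the three-term form -/

section Explicit

variable {P : Params} {β' : Type*}

/-- `tr(M·e_{ji}) = M_{ij}` for the matrix unit `e_{ji} = Matrix.single j i 1`. [folklore] -/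
theorem trace_mul_single_one {n : Type*} [Fintype n] [DecidableEq n] (M : Matrix n n ℂ) (i j : n) :
    Matrix.trace (M * Matrix.single j i (1 : ℂ)) = M i j := by
  rw [Matrix.trace]
  simp only [Matrix.diag_apply]
  rw [Finset.sum_eq_single i]
  · rw [Matrix.mul_single_apply_same, mul_one]
  · intro a _ ha
    simp [Matrix.mul_apply, Ne.symm ha]
  · intro h; exact absurd (Finset.mem_univ i) h

/-- A one-bond matrix field is the scalar indicator times the matrix: `(Pi.single b M)(x) = 𝟙_b(x)•M`. [folklore] -/
theorem single_field_apply (b x : PBond P 0) (M : Matrix (Fin 2) (Fin 2) ℂ) :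
    (Pi.single b M : PBond P 0 → Matrix (Fin 2) (Fin 2) ℂ) x = ((Pi.single b (1 : ℂ) : PBond P 0 → ℂ) x) • M := by
  by_cases hx : x = b
  · subst hx; simp
  · simp [hx]

/-- Reassembling a field from its one-bond pieces against the scalar indicators: `Σ_{b′} 𝟙_{b′}(x)•V(b′) = V(x)`. [folklore] -/
theorem sum_indicator_smul_apply (V : PBond P 0 → Matrix (Fin 2) (Fin 2) ℂ) (x : PBond P 0) :
    ∑ b' : PBond P 0, ((Pi.single b' (1 : ℂ) : PBond P 0 → ℂ) x) • V b' = V x := by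
  have h : ∀ b' : PBond P 0, ((Pi.single b' (1 : ℂ) : PBond P 0 → ℂ) x) • V b' = if x = b' then V b' else 0 := by
    intro b'
    by_cases hx : x = b'
    · subst hx; simp
    · simp [hx]
  simp_rw [h]
  rw [Finset.sum_ite_eq]
  simp

/-- **SUMMATION BY PARTS FOR THE PLAQUETTE FORM**: `Σ_p tr(Φ_p(A)·Φ_p(V)) = Σ_{b′} tr((Σ_p σ(p,b′)•Φ_p(A))·V(b′))` with the incidence signs
`σ(p,b′) = Φ_p(𝟙_{b′})` — i.e. `(η²/2)Σ_p tr(Φ_p(A)Φ_p(V)) = ⟪½·CC A, V⟫` for the pairing `⟪X, V⟫ = η⁴Σ_b tr(X_bV_b)` and the flat curl–curl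
`CC A (b) = η⁻²Σ_p σ(p,b)Φ_p(A)`. [cite: Balaban1985Variational, (5) p.278, (27) p.282, (157) p.302] -/
theorem sum_trace_plaq_mul (A V : PBond P 0 → Matrix (Fin 2) (Fin 2) ℂ) :
    ∑ p : Plaq P 0, Matrix.trace ((A ⟨p.src, p.μ⟩ + A ⟨p.src.shift p.μ, p.ν⟩ - A ⟨p.src.shift p.ν, p.μ⟩ - A ⟨p.src, p.ν⟩) *
        (V ⟨p.src, p.μ⟩ + V ⟨p.src.shift p.μ, p.ν⟩ - V ⟨p.src.shift p.ν, p.μ⟩ - V ⟨p.src, p.ν⟩)) =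
      ∑ b' : PBond P 0, Matrix.trace ((∑ p : Plaq P 0,
        ((Pi.single b' (1 : ℂ) : PBond P 0 → ℂ) ⟨p.src, p.μ⟩ + (Pi.single b' (1 : ℂ) : PBond P 0 → ℂ) ⟨p.src.shift p.μ, p.ν⟩ -
            (Pi.single b' (1 : ℂ) : PBond P 0 → ℂ) ⟨p.src.shift p.ν, p.μ⟩ - (Pi.single b' (1 : ℂ) : PBond P 0 → ℂ) ⟨p.src, p.ν⟩) •
          (A ⟨p.src, p.μ⟩ + A ⟨p.src.shift p.μ, p.ν⟩ - A ⟨p.src.shift p.ν, p.μ⟩ - A ⟨p.src, p.ν⟩)) * V b') := by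
  -- expand the right-hand side and exchange the sums
  simp only [Finset.sum_mul, Matrix.trace_sum, Matrix.smul_mul, Matrix.trace_smul, smul_eq_mul]
  rw [Finset.sum_comm]
  refine Finset.sum_congr rfl fun p _ => ?_
  -- `Σ_{b′} σ(p,b′)·tr(Φ_p(A)·V(b′)) = tr(Φ_p(A)·Φ_p(V))`
  have key : ∑ b' : PBond P 0,
      ((Pi.single b' (1 : ℂ) : PBond P 0 → ℂ) ⟨p.src, p.μ⟩ + (Pi.single b' (1 : ℂ) : PBond P 0 → ℂ) ⟨p.src.shift p.μ, p.ν⟩ -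
          (Pi.single b' (1 : ℂ) : PBond P 0 → ℂ) ⟨p.src.shift p.ν, p.μ⟩ - (Pi.single b' (1 : ℂ) : PBond P 0 → ℂ) ⟨p.src, p.ν⟩) • V b' =
      V ⟨p.src, p.μ⟩ + V ⟨p.src.shift p.μ, p.ν⟩ - V ⟨p.src.shift p.ν, p.μ⟩ - V ⟨p.src, p.ν⟩ := by
    simp only [add_smul, sub_smul, Finset.sum_add_distrib, Finset.sum_sub_distrib, sum_indicator_smul_apply]
  rw [← key, Matrix.mul_sum, Matrix.trace_sum]
  refine Finset.sum_congr rfl fun b' _ => ?_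
  rw [Matrix.mul_smul, Matrix.trace_smul, smul_eq_mul]

/-- **THE EXPLICIT DRESSING TERM IS `E = −½·CC(H∘D) − ½·T_Yᵀ[CC∘Ψ] − T_Yᵀ[W₀∘Ψ]`**: the field `E` of `HalvingDressedCriticality.fderiv_dressed_eq_pairing`
(entries `η⁻⁴·ℓ_Y(e_{b,ji})` of the remainder functional) equals, bond by bond, `−½·CC(H(D Y))(b) − ½·(T_Yᵀ[CC(Y − H(D Y))])(b) −
(T_Yᵀ[W₀(Y − H(D Y))])(b)` with the flat curl–curl `CC Z (b) = η⁻²·Σ_p σ(p,b)•Φ_p(Z)` (`σ(p,b) = Φ_p(𝟙_b)`) and the transpose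
`(T_Yᵀ J)(b) = (Σ_{b′} tr(J(b′)·(H(D′(Y)e_{b,ji}))(b′)))_{ij}` of `T_Y = H∘D′(Y)` for the pairing `η⁴Σ_b tr(X_b δ_b)` — the three (85)–(89)-type terms
`E₁`, `E₂`, `E₃` at `J = 0`. [cite: Balaban1985Variational, (80) p.290, (84)-(89) pp.290-291, (157) p.302] -/
theorem dressing_eq_three_terms (η : ℝ) (hη : η ≠ 0)
    (W₀ : (PBond P 0 → Matrix (Fin 2) (Fin 2) ℂ) → (PBond P 0 → Matrix (Fin 2) (Fin 2) ℂ))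
    (H : (β' → Matrix (Fin 2) (Fin 2) ℂ) →ₗ[ℂ] (PBond P 0 → Matrix (Fin 2) (Fin 2) ℂ))
    (D : (PBond P 0 → Matrix (Fin 2) (Fin 2) ℂ) → (β' → Matrix (Fin 2) (Fin 2) ℂ))
    (E : (PBond P 0 → Matrix (Fin 2) (Fin 2) ℂ) → (PBond P 0 → Matrix (Fin 2) (Fin 2) ℂ))
    (hE : ∀ (Y : PBond P 0 → Matrix (Fin 2) (Fin 2) ℂ) (b : PBond P 0) (i j : Fin 2), E Y b i j = ((η : ℂ) ^ 4)⁻¹ *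
      (-(((η : ℂ) ^ 2 / 2) * ∑ p : Plaq P 0, Matrix.trace ((H (D Y) ⟨p.src, p.μ⟩ + H (D Y) ⟨p.src.shift p.μ, p.ν⟩ - H (D Y) ⟨p.src.shift p.ν, p.μ⟩ - H (D Y) ⟨p.src, p.ν⟩) *
          ((Pi.single b (Matrix.single j i (1 : ℂ)) : PBond P 0 → Matrix (Fin 2) (Fin 2) ℂ) ⟨p.src, p.μ⟩ + (Pi.single b (Matrix.single j i (1 : ℂ)) : PBond P 0 → Matrix (Fin 2) (Fin 2) ℂ) ⟨p.src.shift p.μ, p.ν⟩ -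
            (Pi.single b (Matrix.single j i (1 : ℂ)) : PBond P 0 → Matrix (Fin 2) (Fin 2) ℂ) ⟨p.src.shift p.ν, p.μ⟩ - (Pi.single b (Matrix.single j i (1 : ℂ)) : PBond P 0 → Matrix (Fin 2) (Fin 2) ℂ) ⟨p.src, p.ν⟩)))
        - ((η : ℂ) ^ 2 / 2) * ∑ p : Plaq P 0, Matrix.trace (((Y - H (D Y)) ⟨p.src, p.μ⟩ + (Y - H (D Y)) ⟨p.src.shift p.μ, p.ν⟩ - (Y - H (D Y)) ⟨p.src.shift p.ν, p.μ⟩ - (Y - H (D Y)) ⟨p.src, p.ν⟩) *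
          (H (fderiv ℂ D Y (Pi.single b (Matrix.single j i (1 : ℂ)))) ⟨p.src, p.μ⟩ + H (fderiv ℂ D Y (Pi.single b (Matrix.single j i (1 : ℂ)))) ⟨p.src.shift p.μ, p.ν⟩ -
            H (fderiv ℂ D Y (Pi.single b (Matrix.single j i (1 : ℂ)))) ⟨p.src.shift p.ν, p.μ⟩ - H (fderiv ℂ D Y (Pi.single b (Matrix.single j i (1 : ℂ)))) ⟨p.src, p.ν⟩))
        - (η : ℂ) ^ 4 * ∑ b' : PBond P 0, Matrix.trace (W₀ (Y - H (D Y)) b' * H (fderiv ℂ D Y (Pi.single b (Matrix.single j i (1 : ℂ)))) b')))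
    (Y : PBond P 0 → Matrix (Fin 2) (Fin 2) ℂ) (b : PBond P 0) :
    E Y b =
      -((2 : ℂ)⁻¹ • ((fun (Z : PBond P 0 → Matrix (Fin 2) (Fin 2) ℂ) (b₀ : PBond P 0) => ((η : ℂ) ^ 2)⁻¹ • ∑ p : Plaq P 0,
          ((Pi.single b₀ (1 : ℂ) : PBond P 0 → ℂ) ⟨p.src, p.μ⟩ + (Pi.single b₀ (1 : ℂ) : PBond P 0 → ℂ) ⟨p.src.shift p.μ, p.ν⟩ -
              (Pi.single b₀ (1 : ℂ) : PBond P 0 → ℂ) ⟨p.src.shift p.ν, p.μ⟩ - (Pi.single b₀ (1 : ℂ) : PBond P 0 → ℂ) ⟨p.src, p.ν⟩) •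
            (Z ⟨p.src, p.μ⟩ + Z ⟨p.src.shift p.μ, p.ν⟩ - Z ⟨p.src.shift p.ν, p.μ⟩ - Z ⟨p.src, p.ν⟩)) (H (D Y)) b))
      - (2 : ℂ)⁻¹ • ((fun (Y₀ J : PBond P 0 → Matrix (Fin 2) (Fin 2) ℂ) (b₀ : PBond P 0) => Matrix.of fun i j =>
          ∑ b' : PBond P 0, Matrix.trace (J b' * H (fderiv ℂ D Y₀ (Pi.single b₀ (Matrix.single j i (1 : ℂ)))) b')) Y
          ((fun (Z : PBond P 0 → Matrix (Fin 2) (Fin 2) ℂ) (b₀ : PBond P 0) => ((η : ℂ) ^ 2)⁻¹ • ∑ p : Plaq P 0,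
            ((Pi.single b₀ (1 : ℂ) : PBond P 0 → ℂ) ⟨p.src, p.μ⟩ + (Pi.single b₀ (1 : ℂ) : PBond P 0 → ℂ) ⟨p.src.shift p.μ, p.ν⟩ -
                (Pi.single b₀ (1 : ℂ) : PBond P 0 → ℂ) ⟨p.src.shift p.ν, p.μ⟩ - (Pi.single b₀ (1 : ℂ) : PBond P 0 → ℂ) ⟨p.src, p.ν⟩) •
              (Z ⟨p.src, p.μ⟩ + Z ⟨p.src.shift p.μ, p.ν⟩ - Z ⟨p.src.shift p.ν, p.μ⟩ - Z ⟨p.src, p.ν⟩)) (Y - H (D Y))) b)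
      - (fun (Y₀ J : PBond P 0 → Matrix (Fin 2) (Fin 2) ℂ) (b₀ : PBond P 0) => Matrix.of fun i j =>
          ∑ b' : PBond P 0, Matrix.trace (J b' * H (fderiv ℂ D Y₀ (Pi.single b₀ (Matrix.single j i (1 : ℂ)))) b')) Y (W₀ (Y - H (D Y))) b := by
  have hη' : (η : ℂ) ≠ 0 := Complex.ofReal_ne_zero.2 hη
  ext i j
  rw [hE Y b i j]
  -- the two plaquette sums by parts
  rw [sum_trace_plaq_mul (H (D Y)) (Pi.single b (Matrix.single j i (1 : ℂ))),
    sum_trace_plaq_mul (Y - H (D Y)) (H (fderiv ℂ D Y (Pi.single b (Matrix.single j i (1 : ℂ)))))]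
  -- the first: only `b′ = b` survives, and `tr(M·e_{ji}) = M_{ij}`
  rw [Finset.sum_eq_single b (fun b' _ hb' => by rw [Pi.single_eq_of_ne hb', Matrix.mul_zero, Matrix.trace_zero])
    (fun h => absurd (Finset.mem_univ b) h), Pi.single_eq_same, trace_mul_single_one]
  -- compare
  simp only [Matrix.sub_apply, Matrix.neg_apply, Matrix.smul_apply, Matrix.of_apply, smul_eq_mul, Matrix.smul_mul,
    Matrix.trace_smul, ← Finset.mul_sum]
  field_simp

end Explicit

/-! ## §3 The dressing letter and (98) for the dressed gradient at level-0 bonds, general level weights -/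

section Weighted

variable {P : Params} {β' : Type*}

/-- **THE M2 KNIT AT LEVEL-0 BONDS, GENERAL LEVEL WEIGHTS** (`w 1`, `w 2·c`, `w 3` on `PBond P 0`, `c` = the lattice factor `L^{K−n}`; the cube-sequence
socket's currency).  For the EXPLICIT dressing term `E` of `HalvingDressedCriticality.fderiv_dressed_eq_pairing` (hypothesis `hE`, verbatim) and
`W Y = W₀(Y − H(D Y)) + E Y`: the DISPLAYED supplier letters — (98)₀ for `W₀` (`C₀` below `a₀`), (46) for `H` (`B_H`, both letters), (55) for `D`
(`4C₂r²` below `R`), **(X1)** the curl–curl sup row of `H` (`CC Z b = η⁻²Σ_p σ(p,b)•Φ_p(Z)` = entrywise P2's `dcsE η⁻¹ ∘ dcE η⁻¹`), **(X2a)** the composite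
transpose letter `w₃‖T_Yᵀ[CC Z]‖ ≤ B₂·r·s` and **(X2-T)** `w₃‖T_Yᵀ J‖ ≤ B₃·r·t` (`T_Yᵀ J = (Σ_{b′} tr(J_{b′}·(H(D′(Y)e_{b,ji}))_{b′}))_{ij}`, the
`Matrix.of` shape of `DressingTransposeLetters`) — give Proposition 4's (98) for `W`:
`w 3 b·‖W(Y)(b)‖ ≤ (C₀θ² + 2B_ΔC₂ + ½B₂θ + B₃R₀C₀θ²)·r²` for all `Y` with `w 1 b‖Y b‖ ≤ r`, `w 2 b·c·‖Y(b+e_ν) − Y(b)‖ ≤ r`, `r < a₃`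
(`a₃ ≤ R₀ < R`, `θa₃ ≤ a₀`, `θ = 1 + 4B_HC₂R₀`).  NO supplier letter is proved here.
[cite: Balaban1985Variational, (46) p.285, (55) p.286, (80)-(89) pp.290-291, Prop. 4 (97)-(98) pp.292-293, (157)-(158) p.302] -/
theorem hWq_dressed_of_letters (η : ℝ) (hη : η ≠ 0) (w : ℕ → PBond P 0 → ℝ) (hw : ∀ m b, 0 ≤ w m b) (c : ℝ) (hc : 0 ≤ c)
    (W W₀ E : (PBond P 0 → Matrix (Fin 2) (Fin 2) ℂ) → (PBond P 0 → Matrix (Fin 2) (Fin 2) ℂ))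
    (H : (β' → Matrix (Fin 2) (Fin 2) ℂ) →ₗ[ℂ] (PBond P 0 → Matrix (Fin 2) (Fin 2) ℂ)) (D : (PBond P 0 → Matrix (Fin 2) (Fin 2) ℂ) → (β' → Matrix (Fin 2) (Fin 2) ℂ))
    {C₀ a₀ B_H C₂ R R₀ a₃ B_Δ B₂ B₃ : ℝ}
    (hW : ∀ Y, W Y = W₀ (Y - H (D Y)) + E Y)
    (hE : ∀ (Y : PBond P 0 → Matrix (Fin 2) (Fin 2) ℂ) (b : PBond P 0) (i j : Fin 2), E Y b i j = ((η : ℂ) ^ 4)⁻¹ *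
      (-(((η : ℂ) ^ 2 / 2) * ∑ p : Plaq P 0, Matrix.trace ((H (D Y) ⟨p.src, p.μ⟩ + H (D Y) ⟨p.src.shift p.μ, p.ν⟩ - H (D Y) ⟨p.src.shift p.ν, p.μ⟩ - H (D Y) ⟨p.src, p.ν⟩) *
          (((Pi.single b (Matrix.single j i (1 : ℂ)) : PBond P 0 → Matrix (Fin 2) (Fin 2) ℂ)) ⟨p.src, p.μ⟩ + ((Pi.single b (Matrix.single j i (1 : ℂ)) : PBond P 0 → Matrix (Fin 2) (Fin 2) ℂ)) ⟨p.src.shift p.μ, p.ν⟩ -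
            ((Pi.single b (Matrix.single j i (1 : ℂ)) : PBond P 0 → Matrix (Fin 2) (Fin 2) ℂ)) ⟨p.src.shift p.ν, p.μ⟩ - ((Pi.single b (Matrix.single j i (1 : ℂ)) : PBond P 0 → Matrix (Fin 2) (Fin 2) ℂ)) ⟨p.src, p.ν⟩)))
        - ((η : ℂ) ^ 2 / 2) * ∑ p : Plaq P 0, Matrix.trace (((Y - H (D Y)) ⟨p.src, p.μ⟩ + (Y - H (D Y)) ⟨p.src.shift p.μ, p.ν⟩ - (Y - H (D Y)) ⟨p.src.shift p.ν, p.μ⟩ - (Y - H (D Y)) ⟨p.src, p.ν⟩) *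
          (H (fderiv ℂ D Y (Pi.single b (Matrix.single j i (1 : ℂ)))) ⟨p.src, p.μ⟩ + H (fderiv ℂ D Y (Pi.single b (Matrix.single j i (1 : ℂ)))) ⟨p.src.shift p.μ, p.ν⟩ -
            H (fderiv ℂ D Y (Pi.single b (Matrix.single j i (1 : ℂ)))) ⟨p.src.shift p.ν, p.μ⟩ - H (fderiv ℂ D Y (Pi.single b (Matrix.single j i (1 : ℂ)))) ⟨p.src, p.ν⟩))
        - (η : ℂ) ^ 4 * ∑ b' : PBond P 0, Matrix.trace (W₀ (Y - H (D Y)) b' * H (fderiv ℂ D Y (Pi.single b (Matrix.single j i (1 : ℂ)))) b')))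
    (hW₀ : ∀ (Z : PBond P 0 → Matrix (Fin 2) (Fin 2) ℂ) (s : ℝ), s < a₀ → (∀ b, w 1 b * ‖Z b‖ ≤ s) →
      (∀ (b : PBond P 0) (ν : Fin P.d), w 2 b * c * ‖Z ⟨b.src.shift ν, b.dir⟩ - Z b‖ ≤ s) → ∀ b, w 3 b * ‖W₀ Z b‖ ≤ C₀ * s ^ 2)
    (hH : ∀ (X : β' → Matrix (Fin 2) (Fin 2) ℂ) (t : ℝ), (∀ c', ‖X c'‖ ≤ t) →
      (∀ b, w 1 b * ‖H X b‖ ≤ B_H * t) ∧ ∀ (b : PBond P 0) (ν : Fin P.d), w 2 b * c * ‖H X ⟨b.src.shift ν, b.dir⟩ - H X b‖ ≤ B_H * t)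
    (hD : ∀ (Y : PBond P 0 → Matrix (Fin 2) (Fin 2) ℂ) (r' : ℝ), r' < R → (∀ b, w 1 b * ‖Y b‖ ≤ r') →
      (∀ (b : PBond P 0) (ν : Fin P.d), w 2 b * c * ‖Y ⟨b.src.shift ν, b.dir⟩ - Y b‖ ≤ r') → ∀ c', ‖D Y c'‖ ≤ 4 * C₂ * r' ^ 2)
    (hX1 : ∀ (X : β' → Matrix (Fin 2) (Fin 2) ℂ) (t : ℝ), 0 ≤ t → (∀ c', ‖X c'‖ ≤ t) → ∀ b : PBond P 0,
      w 3 b * ‖(((η : ℂ) ^ 2)⁻¹ • ∑ p : Plaq P 0, ((Pi.single b (1 : ℂ) : PBond P 0 → ℂ) ⟨p.src, p.μ⟩ + (Pi.single b (1 : ℂ) : PBond P 0 → ℂ) ⟨p.src.shift p.μ, p.ν⟩ - (Pi.single b (1 : ℂ) : PBond P 0 → ℂ) ⟨p.src.shift p.ν, p.μ⟩ - (Pi.single b (1 : ℂ) : PBond P 0 → ℂ) ⟨p.src, p.ν⟩) • (H X ⟨p.src, p.μ⟩ + H X ⟨p.src.shift p.μ, p.ν⟩ - H X ⟨p.src.shift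 p.ν, p.μ⟩ - H X ⟨p.src, p.ν⟩))‖ ≤ B_Δ * t)
    (hX2a : ∀ (Y : PBond P 0 → Matrix (Fin 2) (Fin 2) ℂ) (r : ℝ), r < R → (∀ b, w 1 b * ‖Y b‖ ≤ r) →
      (∀ (b : PBond P 0) (ν : Fin P.d), w 2 b * c * ‖Y ⟨b.src.shift ν, b.dir⟩ - Y b‖ ≤ r) →
      ∀ (Z : PBond P 0 → Matrix (Fin 2) (Fin 2) ℂ) (s : ℝ), 0 ≤ s → (∀ b, w 1 b * ‖Z b‖ ≤ s) →
      (∀ (b : PBond P 0) (ν : Fin P.d), w 2 b * c * ‖Z ⟨b.src.shift ν, b.dir⟩ - Z b‖ ≤ s) → ∀ b : PBond P 0,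
      w 3 b * ‖(Matrix.of fun i j => ∑ b' : PBond P 0, Matrix.trace ((((η : ℂ) ^ 2)⁻¹ • ∑ p : Plaq P 0, ((Pi.single b' (1 : ℂ) : PBond P 0 → ℂ) ⟨p.src, p.μ⟩ + (Pi.single b' (1 : ℂ) : PBond P 0 → ℂ) ⟨p.src.shift p.μ, p.ν⟩ - (Pi.single b' (1 : ℂ) : PBond P 0 → ℂ) ⟨p.src.shift p.ν, p.μ⟩ - (Pi.single b' (1 : ℂ) : PBond P 0 → ℂ) ⟨p.src, p.ν⟩) • (Z ⟨p.src, p.μ⟩ + Z ⟨p.src.shift p.μ, p.ν⟩ - Z ⟨p.src.shift p.ν, p.μ⟩ - Z ⟨p.src, p.ν⟩)) * H (fderiv ℂ D Y (Pi.single b (Matrix.single j i (1 : ℂ)))) b'))‖ ≤ B₂ * r * s)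
    (hX2T : ∀ (Y : PBond P 0 → Matrix (Fin 2) (Fin 2) ℂ) (r : ℝ), r < R → (∀ b, w 1 b * ‖Y b‖ ≤ r) →
      (∀ (b : PBond P 0) (ν : Fin P.d), w 2 b * c * ‖Y ⟨b.src.shift ν, b.dir⟩ - Y b‖ ≤ r) →
      ∀ (J : PBond P 0 → Matrix (Fin 2) (Fin 2) ℂ) (t : ℝ), 0 ≤ t → (∀ b, w 3 b * ‖J b‖ ≤ t) → ∀ b : PBond P 0,
      w 3 b * ‖(Matrix.of fun i j => ∑ b' : PBond P 0, Matrix.trace (J b' * H (fderiv ℂ D Y (Pi.single b (Matrix.single j i (1 : ℂ)))) b'))‖ ≤ B₃ * r * t)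
    (hC₂ : 0 ≤ C₂) (hB_H : 0 ≤ B_H) (hB₃ : 0 ≤ B₃) (hR₀0 : 0 ≤ R₀) (hR₀ : R₀ < R) (ha₃ : a₃ ≤ R₀) (hθ : (1 + 4 * B_H * C₂ * R₀) * a₃ ≤ a₀) :
    ∀ (Y : PBond P 0 → Matrix (Fin 2) (Fin 2) ℂ) (r : ℝ), r < a₃ → (∀ b, w 1 b * ‖Y b‖ ≤ r) →
      (∀ (b : PBond P 0) (ν : Fin P.d), w 2 b * c * ‖Y ⟨b.src.shift ν, b.dir⟩ - Y b‖ ≤ r) →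
      ∀ b, w 3 b * ‖W Y b‖ ≤
        (C₀ * (1 + 4 * B_H * C₂ * R₀) ^ 2 +
          (2 * B_Δ * C₂ + 2⁻¹ * B₂ * (1 + 4 * B_H * C₂ * R₀) + B₃ * R₀ * C₀ * (1 + 4 * B_H * C₂ * R₀) ^ 2)) * r ^ 2 := by
  -- the generic currency: `ι = PBond P 0`, `κ = PBond P 0 × Fin d`, `src q = q.1`, `tgt q = q.1 + e_{q.2}`, `w₀ = w 1`, `w₁ = w 2·c`, `w₃ = w 3`
  let src : PBond P 0 × Fin P.d → PBond P 0 := fun q => q.1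
  let tgt : PBond P 0 × Fin P.d → PBond P 0 := fun q => ⟨q.1.src.shift q.2, q.1.dir⟩
  have toP : ∀ (Y : PBond P 0 → Matrix (Fin 2) (Fin 2) ℂ) (r : ℝ), (∀ (b : PBond P 0) (ν : Fin P.d), w 2 b * c * ‖Y ⟨b.src.shift ν, b.dir⟩ - Y b‖ ≤ r) →
      ∀ q : PBond P 0 × Fin P.d, w 2 q.1 * c * ‖Y (tgt q) - Y (src q)‖ ≤ r := fun Y r h q => h q.1 q.2
  have ofP : ∀ (Y : PBond P 0 → Matrix (Fin 2) (Fin 2) ℂ) (r : ℝ), (∀ q : PBond P 0 × Fin P.d, w 2 q.1 * c * ‖Y (tgt q) - Y (src q)‖ ≤ r) →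
      ∀ (b : PBond P 0) (ν : Fin P.d), w 2 b * c * ‖Y ⟨b.src.shift ν, b.dir⟩ - Y b‖ ≤ r := fun Y r h b ν => h (b, ν)
  intro Y r hr h1 h2 b
  exact hWq_of_letters src tgt (w 1) (w 3) (fun q => w 2 q.1 * c) W E W₀
    (fun (Z : PBond P 0 → Matrix (Fin 2) (Fin 2) ℂ) (b₀ : PBond P 0) => (((η : ℂ) ^ 2)⁻¹ • ∑ p : Plaq P 0, ((Pi.single b₀ (1 : ℂ) : PBond P 0 → ℂ) ⟨p.src, p.μ⟩ + (Pi.single b₀ (1 : ℂ) : PBond P 0 → ℂ) ⟨p.src.shift p.μ, p.ν⟩ - (Pi.single b₀ (1 : ℂ) : PBond P 0 → ℂ) ⟨p.src.shift p.ν, p.μ⟩ - (Pi.single b₀ (1 : ℂ) : PBond P 0 → ℂ) ⟨p.src, p.ν⟩) • (Z ⟨p.src, p.μ⟩ + Z ⟨p.src.shift p.μ, p.ν⟩ - Z ⟨p.src.shift p.ν, p.μ⟩ - Z ⟨p.src, p.ν⟩)))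
    (fun (Y₀ J : PBond P 0 → Matrix (Fin 2) (Fin 2) ℂ) (b₀ : PBond P 0) => (Matrix.of fun i j => ∑ b' : PBond P 0, Matrix.trace (J b' * H (fderiv ℂ D Y₀ (Pi.single b₀ (Matrix.single j i (1 : ℂ)))) b')))
    H D hW (dressing_eq_three_terms η hη W₀ H D E hE)
    (fun Z s hs hZ1 hZ2 => hW₀ Z s hs hZ1 (ofP Z s hZ2))
    (fun X t hX => ⟨(hH X t hX).1, toP _ _ (hH X t hX).2⟩)
    (fun Y r' hr' hY1 hY2 => hD Y r' hr' hY1 (ofP Y r' hY2))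
    hX1
    (fun Y r hr hY1 hY2 Z s hs hZ1 hZ2 => hX2a Y r hr hY1 (ofP Y r hY2) Z s hs hZ1 (ofP Z s hZ2))
    (fun Y r hr hY1 hY2 J t ht hJ => hX2T Y r hr hY1 (ofP Y r hY2) J t ht hJ)
    hC₂ hB_H hB₃ hR₀0 hR₀ ha₃ hθ (fun b => hw 1 b) (fun q => mul_nonneg (hw 2 q.1) hc) (fun b => hw 3 b)
    Y r hr h1 (toP Y r h2) b

end Weighted

end Summit.QuantumFields.YangMills.Theorems.HalvingDressingLetter

end
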